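import Summits.KontsevichZagierPeriods.KontsevichZagierPeriods.Theses.CoactionDevissage
import Summits.KontsevichZagierPeriods.KontsevichZagierPeriods.Theorems.FurushoPentagonShuffleIsDissection

/-!
# `Shuffle` (stmt-KontsevichZagierPeriods-3172, route CoactionDevissage) — proof

Statement: with `ρ u := [KZ.mzvRep u]` for admissible `u` (and `0` otherwise), for all admissible
indices `s`, `t` the shuffle defect `ρ s · ρ t − Σ_{w ∈ ε(s) ш ε(t)} ρ (index of w)` (`MZV.shuffleWord`
of the binary words `MZV.binaryWord`, read back by `MZV.ofBinaryWord`, with multiplicity) lies in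
`KZ.relations`: the shuffle product of multiple zeta values is realised by moves, not only as the real
identity `multipleZeta_mul_eq_sum_shuffleWord`.

Proof: the route FurushoPentagon filed the same content for an ARBITRARY assignment `Z` pinned to the
simplex classes on admissible indices, `ShuffleIsDissection` (twin item stmt-3932), and the tree proves
it: `Summit.KontsevichZagierPeriods.FurushoPentagon.ShuffleIsDissection.shuffleIsDissection_proof`
(`Theorems/FurushoPentagonShuffleIsDissection.lean`, composing
`MzvKernelInKZ.TwoPosets.stub_shuffleProduct` — the product representation on `Δ_s × Δ_t`
(`KZ.of_mul_of`) is dissected, off the Lebesgue-null tie walls `{xᵢ = yⱼ}`, into the shuffle cells by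
domain additivity (rule (1a), `KZ.of_sub_sum_of_mem_relations`), each cell being the reindexing of a
standard word simplex along its sorting permutation (rule (2), `KZ.of_sub_of_reindex_mem_relations`),
the interleaved word recording which coordinate came from which factor — with the bookkeeping
`MzvKernelInKZ.TwoPosets.stub_shuffleIsDissectionOfLine`: word representations of admissible indices
are `KZ.mzvRep`, interleavings of admissible words are admissible, and `s = []` / `t = []` is the unit
law of the Fubini product modulo one reindexing move). The route's `ρ` is such an assignment
(`dif_pos`), so the item is the instance `Z := ρ`. This file closes the item by that theorem (lead c10
of line `Sketch` of crux `TateLifting`, banking calculus theorems where they close items). No new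
mathematics.

References: M. Kontsevich, D. Zagier, *Periods* (2001), §1.2; I. Soudères, *Motivic double shuffle*,
Int. J. Number Theory 6 (2010), §1.2 (arXiv:0808.0248); M. Eie, *The Theory of Multiple Zeta Values
with Applications in Combinatorics* (2013), §1.2.
-/

namespace Summit.KontsevichZagierPeriods.CoactionDevissage

open Literature.NumberTheory.Transcendental

/-- **`Shuffle`** (route CoactionDevissage, stmt-KontsevichZagierPeriods-3172): for admissible `s`, `t`,
`[mzvRep s]·[mzvRep t] − Σ_{w ∈ ε(s) ш ε(t)} [mzvRep (index of w)] ∈ KZ.relations` (with the route's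
`ρ`). Proof: `ρ` agrees with `[mzvRep u]` on admissible `u` (`dif_pos`), so this is the instance
`Z := ρ` of the dissection theorem `FurushoPentagon.ShuffleIsDissection.shuffleIsDissection_proof`
(product of simplices = union of shuffle cells up to null tie walls, rule (1a); each cell a coordinate
permutation of a word simplex, rule (2)). [Kontsevich–Zagier 2001, §1.2; arXiv:0808.0248, §1.2]
[folklore] -/
theorem shuffle_proof :
    Summit.KontsevichZagierPeriods.KontsevichZagierPeriods.Theses.CoactionDevissage.Shuffle := by
  intro s t hs ht
  -- the route's assignment `ρ`, written out (it is pinned to `[mzvRep u]` on admissible `u` by `dif_pos`)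
  have key := Summit.KontsevichZagierPeriods.FurushoPentagon.ShuffleIsDissection.shuffleIsDissection_proof
    (fun u => if h : MZV.IsAdmissible u then KZ.of (KZ.mzvRep u h
      (KZ.mzvIntegrand_isSemialgebraicFunOn_holds u) (KZ.mzvIntegrand_integrableOn_holds u h)) else 0)
    (fun u hu => dif_pos hu) s t hs ht
  exact key

end Summit.KontsevichZagierPeriods.CoactionDevissage
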